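import Summits.QuantumFields.YangMills.Theorems.BalabanUVNodesN09AtRecord13SepCoPHLoc

/-!
# NODE N09 — THE (181)ˢᵒˡ BINDER `hcov` OF THE STAGE-13 `SepCoPH` JUNCTION IS [B11] THM 1'S UNIQUENESS CLAUSE + THE AXIAL-GAUGE
# CONVENTION OF [I] (2.3): (181) modulo the residual group for ANY selection of minimisers; the block axial gauge kills the residue;
# the junction `thm3Member_stage13SepCoPH_of_stepsOnLoc` re-keyed on uniqueness + axiality ON THE BOOKKEEPING SETS `D (j+1)`

TRACK A (YM-PLAN §2d, node N09 of 28), seat `pub-ymgap-dag-n09-w2` (D-0149 width seat 2∕4), generation g2, FILE 5.  Key of record: K1⁷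
`StabilityBAtRecordR13SepCoPH` = stmt-QuantumFields-20542; `--supports` it as a helper (Summits lane).  [I] = [Balaban1987RG1] (CMP 109),
[B11] = [Balaban1985Variational] (CMP 102), [B7] = [Balaban1985Averaging] (CMP 98), [B8] = [Balaban1985RegularSpaces] (CMP 99).

WHY.  g0's FILE 4 (`BalabanUVNodesN09AtRecord13SepCoPHLoc`, p591459) re-keyed the junction's Theorem-3 member WITHOUT (M1); its FIRST displayed binder is
(181)ˢᵒˡ `hcov : ∀ j < K, ∀ v W, UkExists (j+1) εreg W → critCfgOfRecord ν K j (W^v) = (critCfgOfRecord ν K j W)^{v∘B}` — unprovable for the record's bare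
choice `Uk = dite (UkExists) Classical.choose 1` (g0's HANDOFF blocker (b)).  Print has TWO sentences here and this file proves that together they ARE `hcov`:
[B11] Thm 1 p. 279 «This orbit is a unique critical orbit in the space (6)» (uniqueness under the residual group (4) «u(y) = 1 for y ∈ 𝔅_k») and [I] (2.3)
p. 265 «… related to the minimal configuration U_{k+1}(W) in the axial gauge by the equality V^{(k)} = Ū^k_{k+1} = M^k(U_{k+1})» (so `V^{(k)}` satisfies the
block axial gauge conditions `𝐆(V) = 0` of `T^{(k)}`, the tree's `Setup.AxialGauge cd`; r09's `B12CriticalPoint23.criticalPoint23` consumes exactly these two).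
* §1 (generic `G`, ANY `cd : ContourData P j G`) the block axial gauge is a COMPLETE gauge of the fine group «u(emb y) = 1»: `eq_one_of_fine_of_axialGauge`
  (r09's inlined uniqueness step as a lemma), `axialGauge_gaugeAct_liftTransf`, `exists_fine_axialGauge`, `exists_axialNormalForm`, `avg_gaugeAct_of_fine`, `avg_ax_eq`.
* §2 (generic `G`, ANY selection `sel` of minimisers of (0.21) at level `k+1`, class `reg` gauge-stable) ★ `orbitRel_blockLift_of_uniqueOrbit` — (181) MODULO THE
  RESIDUAL GROUP from uniqueness alone: `U_{k+1}(W^v) = ((U_{k+1}(W))^{v∘B^{k+1}})^{w}`, `w` residual (g0's `isBackground_gaugeAct_toMS` at r15's `blockLift`);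
  `iter_sel_gaugeAct_of_uniqueOrbit` (its `M^k`: the residue is FINE at level `k`); ★ `iter_sel_gaugeAct_of_axial` (axial at `W` and `W^v` ⇒ covariant there);
  `ax_iter_sel_gaugeAct` (ANY block-axial normal form `ax`: `ax ∘ M^k ∘ sel` covariant, nothing asked of `sel`); level-0 twins `nf_sel_gaugeAct` ∕
  `iter_nf_sel_gaugeAct` ∕ `isBackground_nf_sel` for ANY residual-normal form `nf` commuting with `blockLift` (dag-n09-w4's `rootGauge k` is such an `nf`); `orbitRel_gaugeAct`.
* §3 (record: `SU(N)`, `avOfRecord`, `bgReg`, `Uk … (k+1) ν.εreg`) `uniqueUkOrbit_gaugeAct_iff` (the unique-orbit set is GAUGE-STABLE — companion of g0's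
  `ukExists_gaugeAct_iff`), `Uk_gaugeAct_orbitRel_blockLift`, ★ `critCfgOfRecord_gaugeAct_of_uniqueOrbit_of_axial` ∕ `critCfgOfRecord_covariantOn_of_uniqueOrbit_of_axialOn`
  (`hcov j`'s BODY, verbatim), `chiβ_liftInvariantOn_of_uniqueOrbit_of_axialOn` (`χ^{(2.9)}_j` lift-invariant on `Ū⁻¹(S)` from uniqueness + axiality ON a gauge-stable
  `S ⊆` solvable set), the normal-form contract `ax_critCfgOfRecord_gaugeAct` ∕ `avg_ax_critCfgOfRecord`, ★★
  `thm3Member_stage13SepCoPH_of_stepsOnLoc_of_axialOn` — the junction with `hcov` REPLACED by `huniqD` ([B11] uniqueness at radius `θ.ν.εreg`) + `haxD`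
  (axiality of (2.3) for a contour family `cd j`, e.g. def-B's `contourOfRecord F N P.K j`) ON `D (j+1)` ONLY; every other binder VERBATIM.
LOCATED (not settled here): `haxD` for the bare choice is print's CONVENTION (2.3), not yet carried by the record; §2 certifies that the one-token re-point
`critCfgOfRecord ν K k := ax (M^k (Uk … (k+1) ν.εreg ·))` (or `Uk := nf ∘ Uk`) satisfies it and `hcov` from `UniqueUkOrbit` alone — an OFFER to node00-def, not an
edit; `huniqD` is the displayed N07-type input (dag-n09-w1 g2 derives it on the domains from the junction's `h11`).

HONEST FRAMING: kernel gauge algebra over NODE 00's definitions of record; NOTHING of Bałaban's asserted ([B11] Thm 1's clauses, the axial convention, (I19), the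
side conditions on `D`, [B11] ×3 and the nesting are DISPLAYED hypotheses); NO carrier re-pointed; N09 NOT discharged; K0⁷ ∕ K1⁷ OPEN; counts unmoved (typed
28∕28 · discharged 5∕27); R4 is the conditional finite-𝕋⁴ rung `BalabanLadder.UV` only — NOT continuum ∕ ℝ⁴ ∕ OS ∕ mass gap ∕ Clay.  THEOREMS ONLY (0 `def`,
0 `sorry`, 0 `instance`, 0 `notation`), standard axioms.
-/

noncomputable section

namespace Summit.QuantumFields.YangMills.BalabanUVNodes.N09AxialCovariance181

open MeasureTheory
open Literature.MathematicalPhysics.QuantumFieldTheory.Balaban1983to89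
open Literature.MathematicalPhysics.QuantumFieldTheory.Balaban1983to89.Node00
open B12RTGaugeInvariance254 (liftTransf invTransf liftTransf_emb gaugeAct_inv_gaugeAct gaugeAct_one' holTo_gaugeAct_liftTransf)
open B12GaugeOrbits021 (IsResidual OrbitRel)
open B16Sect1Backgrounds (toMS iter_gaugeAct)
open B15Eq177GaugeInvariance (blockLift toMS_blockLift_self)
open B15DeterminingSets (embIter)
open DagBinding
open GaugeField (gaugeAct)
open Summit.QuantumFields.YangMills.BalabanUVNodes.N09LiftInvariance29AtRecord (isBackground_gaugeAct_toMS gaugeAct_mem_bgReg toMS_blockLift_succ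
  ukExists_gaugeAct_iff succ_le_range_of_lt)
open Literature.MathematicalPhysics.QuantumFieldTheory.Balaban1983to89.B12NodeKnitRecord13SepCoPH (flow_stage13SepCoPH indAss_stage13SepCoPH_iff)
open Summit.QuantumFields.YangMills.BalabanUVNodes.N09LiftInvariance29AtRecord (chiFix29OfRecord_gaugeAct_liftTransf_of_critCfg)
open Summit.QuantumFields.YangMills.BalabanUVNodes.N09RTGaugeInvarianceOn (thm3Member_of_indATPlug_of_stepsOnLoc)
open Summit.QuantumFields.YangMills.BalabanUVNodes.N09AtRecord13SepCoPHLoc (stepOnLoc_TβOfRecord₁₃)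

/-! ## §1. Generic gauge group, level `j`: the block axial gauge is a complete gauge of the fine group `u(emb y) = 1` -/

section Axial

variable {P : Params} {j : ℕ} {G : Type*} [GaugeGroup G]

/-- **UNIQUENESS OF THE AXIAL REPRESENTATIVE IN A FINE ORBIT** ([I] (2.2) «exactly one critical point … choosing the element of the orbit satisfying the
axial gauge conditions»; the step r09's `B12CriticalPoint23.criticalPoint23` inlines): if `V` and `V^w` are both in the block axial gauge of the contour
system `cd` and `w = 1` at the block centres, then `w = 1` identically — off the centres `1 = V^w(Γ_{y,x}) = w(y)·V(Γ_{y,x})·w(x)⁻¹ = w(x)⁻¹`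
(`ContourData.covariant`).  Any `ContourData`, no range hypothesis. [cite: Balaban1987RG1, (2.2)–(2.3) p.265; Balaban1985RegularSpaces, p.79 (sentence after (1.20))] -/
theorem eq_one_of_fine_of_axialGauge (cd : ContourData P j G) {V : GaugeField P j G} (hV : AxialGauge cd V) {w : GaugeTransf P j G}
    (hw : ∀ y : Site P (j + 1), w (emb y) = 1) (hwV : AxialGauge cd (gaugeAct w V)) : w = fun _ => 1 := by
  funext x
  by_cases hx : x = emb (blockOf x)
  · rw [hx]
    exact hw (blockOf x)
  · have h1 := hwV (blockOf x) x rfl hx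
    rw [cd.covariant, hV (blockOf x) x rfl hx, hw (blockOf x)] at h1
    simpa only [one_mul, mul_one, inv_eq_one] using h1

/-- Hence the axial IMAGE in a fine orbit is unique: `V^w = V` for `V`, `V^w` axial and `w` fine. [cite: Balaban1987RG1, (2.2)–(2.3) p.265] -/
theorem gaugeAct_eq_self_of_fine_of_axialGauge (cd : ContourData P j G) {V : GaugeField P j G} (hV : AxialGauge cd V) {w : GaugeTransf P j G}
    (hw : ∀ y : Site P (j + 1), w (emb y) = 1) (hwV : AxialGauge cd (gaugeAct w V)) : gaugeAct w V = V := by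
  rw [eq_one_of_fine_of_axialGauge cd hV hw hwV, gaugeAct_one']

/-- **BLOCK-CONSTANT LIFTS PRESERVE THE BLOCK AXIAL GAUGE** (standing range `j + 1 ≤ m + K`): `V^{v∘blockOf}(Γ_{y,x}) = v(y)·V(Γ_{y,x})·v(y)⁻¹`
(`holTo_gaugeAct_liftTransf`), so `= 1` when `V(Γ_{y,x}) = 1` — the residual freedom of [B8] (1.15) is the block-constant group.
[cite: Balaban1985RegularSpaces, (1.15) p.78; Balaban1987RG1, (2.1) p.265] -/
theorem axialGauge_gaugeAct_liftTransf (hj : j + 1 ≤ P.m + P.K) (cd : ContourData P j G) (v : GaugeTransf P (j + 1) G) {V : GaugeField P j G}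
    (hV : AxialGauge cd V) : AxialGauge cd (gaugeAct (liftTransf v) V) := by
  intro y x hxy hx
  have hxb : x ∈ block y := by simpa [block] using hxy
  rw [holTo_gaugeAct_liftTransf hj cd v V hxb, hV y x hxy hx, mul_one, mul_inv_cancel]

/-- **EVERY FINE ORBIT MEETS THE BLOCK AXIAL GAUGE** ([B7] p. 24 «let us introduce locally the axial gauge with the initial point y»; [B8] (1.15)):
`u(x) = V(Γ_{y(x),x})` off the centres and `u = 1` on them is fine and `V^u` is axial (`V^u(Γ_{y,x}) = u(y)·V(Γ_{y,x})·u(x)⁻¹ = 1`).  Standing range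
`j + 1 ≤ m + K` (`blockOf ∘ emb = id`). [cite: Balaban1985Averaging, p.24 (between (44) and (45)); Balaban1985RegularSpaces, (1.15) p.78] -/
theorem exists_fine_axialGauge (hj : j + 1 ≤ P.m + P.K) (cd : ContourData P j G) (V : GaugeField P j G) :
    ∃ u : GaugeTransf P j G, (∀ y : Site P (j + 1), u (emb y) = 1) ∧ AxialGauge cd (gaugeAct u V) := by
  classical
  refine ⟨fun x => if x = emb (blockOf x) then 1 else cd.holTo V (blockOf x) x, fun y => ?_, fun y x hxy hx => ?_⟩
  · have h : emb y = emb (blockOf (emb y)) := by rw [Site.blockOf_emb hj y]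
    show (if emb y = emb (blockOf (emb y)) then (1 : G) else cd.holTo V (blockOf (emb y)) (emb y)) = 1
    rw [if_pos h]
  · subst hxy
    have h : emb (blockOf x) = emb (blockOf (emb (blockOf x))) := by rw [Site.blockOf_emb hj (blockOf x)]
    rw [cd.covariant]
    show (if emb (blockOf x) = emb (blockOf (emb (blockOf x))) then (1 : G) else cd.holTo V (blockOf (emb (blockOf x))) (emb (blockOf x))) *
        cd.holTo V (blockOf x) x * (if x = emb (blockOf x) then (1 : G) else cd.holTo V (blockOf x) x)⁻¹ = 1
    rw [if_pos h, if_neg hx, one_mul, mul_inv_cancel]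

/-- **A BLOCK-AXIAL NORMAL FORM EXISTS for every contour system** (standing range): a map `ax` on the level-`j` configurations with `ax V = V^u`,
`u` fine, and `ax V` axial, for every `V` (choice over `exists_fine_axialGauge`; by `eq_one_of_fine_of_axialGauge` it is the UNIQUE such map constant
on fine orbits). [cite: Balaban1985RegularSpaces, (1.15) p.78 («determine uniquely an element in each orbit»)] -/
theorem exists_axialNormalForm (hj : j + 1 ≤ P.m + P.K) (cd : ContourData P j G) :
    ∃ ax : GaugeField P j G → GaugeField P j G,
      (∀ V, ∃ u : GaugeTransf P j G, (∀ y : Site P (j + 1), u (emb y) = 1) ∧ ax V = gaugeAct u V) ∧ ∀ V, AxialGauge cd (ax V) := by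
  choose u hu hax using exists_fine_axialGauge hj cd
  exact ⟨fun V => gaugeAct (u V) V, fun V => ⟨u V, hu V, rfl⟩, hax⟩

/-- A fine gauge transformation does not move the one-step average: `M(V^u) = M(V)` for `u = 1` at the centres (`Averaging.covariant`; twin of
`B14Eq16FaddeevPopov.avg_gaugeAct_of_fineGauge`, re-derived to keep the imports of this file to g0's FILE 4). [cite: Balaban1987RG1, (0.13) p.254] -/
theorem avg_gaugeAct_of_fine (hj : j + 1 ≤ P.m + P.K) (av : Averaging P j G) {u : GaugeTransf P j G}
    (hu : ∀ y : Site P (j + 1), u (emb y) = 1) (V : GaugeField P j G) : av.avg (gaugeAct u V) = av.avg V := by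
  rw [av.covariant hj u V]
  have h : (fun y => u (emb y)) = fun _ => (1 : G) := funext hu
  rw [h, gaugeAct_one']

/-- A normal form `ax` (fine-related) keeps every configuration in its fibre: `M(ax V) = M(V)`. [cite: Balaban1987RG1, (2.3)–(2.4) pp.265–266] -/
theorem avg_ax_eq (hj : j + 1 ≤ P.m + P.K) (av : Averaging P j G) {ax : GaugeField P j G → GaugeField P j G}
    (hax₁ : ∀ V, ∃ u : GaugeTransf P j G, (∀ y : Site P (j + 1), u (emb y) = 1) ∧ ax V = gaugeAct u V) (V : GaugeField P j G) :
    av.avg (ax V) = av.avg V := by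
  obtain ⟨u, hu, h⟩ := hax₁ V
  rw [h, avg_gaugeAct_of_fine hj av hu V]

end Axial

/-! ## §2. Generic: (181) MODULO THE RESIDUAL GROUP for ANY selection of minimisers, from uniqueness of the minimal orbit; the axial gauge kills the residue -/

section Selection

variable {P : Params} {G : Type*} [GaugeGroup G] {av : ∀ i, Averaging P i G} {reg : Set (GaugeField P 0 G)} {k : ℕ}
  {sel : GaugeField P (k + 1) G → GaugeField P 0 G} {W : GaugeField P (k + 1) G} {v : GaugeTransf P (k + 1) G}

/-- ★ **(181) MODULO THE RESIDUAL GROUP, FOR ANY SELECTION** — [B11] (181) p. 307 «U_k(V^v) = U_k(V)^{v̄}» read for an ARBITRARY choice of minimiser per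
coarse field: if `sel W` minimises (0.21) over `W` and `sel (W^v)` over `W^v` (class `reg` stable under all gauge transformations of `T_η`, `k + 1 ≤ m + K`),
and the minimal orbit over `W^v` is UNIQUE under the residual group «u = 1 on T^{(k+1)}» ([B11] Thm 1's uniqueness clause — DISPLAYED), then `sel (W^v)` lies in
the residual orbit of `(sel W)^{v∘B^{k+1}}` (g0's transport `isBackground_gaugeAct_toMS` at r15's block-constant lift `blockLift (k+1) v`, whose restriction to
`T^{(k+1)}` is `v`). [cite: Balaban1985Variational, (181) p.307 and Thm 1 p.279; Balaban1987RG1, (0.21) p.256] -/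
theorem orbitRel_blockLift_of_uniqueOrbit (hk : k + 1 ≤ P.m + P.K)
    (hreg : ∀ (u : GaugeTransf P 0 G) (U : GaugeField P 0 G), U ∈ reg → gaugeAct u U ∈ reg)
    (hW : IsBackground av reg (k + 1) W (sel W)) (hvW : IsBackground av reg (k + 1) (gaugeAct v W) (sel (gaugeAct v W)))
    (huniq : ∀ U₀ U₀' : GaugeField P 0 G, IsBackground av reg (k + 1) (gaugeAct v W) U₀ → IsBackground av reg (k + 1) (gaugeAct v W) U₀' →
      OrbitRel (k + 1) U₀ U₀') :
    OrbitRel (k + 1) (gaugeAct (blockLift (k + 1) v) (sel W)) (sel (gaugeAct v W)) := by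
  refine huniq _ _ ?_ hvW
  have h := isBackground_gaugeAct_toMS (av := av) (reg := reg) hk hreg hW (blockLift (k + 1) v)
  rwa [toMS_blockLift_self hk] at h

/-- `M^k` OF (181)-MOD-RESIDUAL: `M^k(sel (W^v)) = ((M^k(sel W))^{v∘blockOf})^{w}` with `w` FINE at level `k` (`w = u↾T^{(k)}` for the residual `u`; a
transformation trivial on `T^{(k+1)} ⊂ T_η` restricts to one trivial at the centres `emb y`; `M^k(U^u) = (M^kU)^{u↾T^{(k)}}`, `(v∘B^{k+1})↾T^{(k)} = v ∘ blockOf`).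
[cite: Balaban1987RG1, (2.3) p.265; Balaban1985Variational, (181) p.307] -/
theorem iter_sel_gaugeAct_of_uniqueOrbit (hk : k + 1 ≤ P.m + P.K)
    (hreg : ∀ (u : GaugeTransf P 0 G) (U : GaugeField P 0 G), U ∈ reg → gaugeAct u U ∈ reg)
    (hW : IsBackground av reg (k + 1) W (sel W)) (hvW : IsBackground av reg (k + 1) (gaugeAct v W) (sel (gaugeAct v W)))
    (huniq : ∀ U₀ U₀' : GaugeField P 0 G, IsBackground av reg (k + 1) (gaugeAct v W) U₀ → IsBackground av reg (k + 1) (gaugeAct v W) U₀' →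
      OrbitRel (k + 1) U₀ U₀') :
    ∃ w : GaugeTransf P k G, (∀ y : Site P (k + 1), w (emb y) = 1) ∧
      Averaging.iter av k (sel (gaugeAct v W)) = gaugeAct w (gaugeAct (liftTransf v) (Averaging.iter av k (sel W))) := by
  obtain ⟨u, hu, hsel⟩ := orbitRel_blockLift_of_uniqueOrbit hk hreg hW hvW huniq
  refine ⟨toMS u k, fun y => ?_, ?_⟩
  · show u (embIter k (emb y)) = 1
    exact hu y
  · rw [hsel, iter_gaugeAct av u _ k (Nat.le_of_succ_le hk), iter_gaugeAct av (blockLift (k + 1) v) _ k (Nat.le_of_succ_le hk),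
      toMS_blockLift_succ (Nat.le_of_succ_le hk) v]

/-- ★ **COVARIANCE OF `M^k ∘ sel` FROM UNIQUENESS + AXIALITY** ([I] (2.3): `V^{(k)}(W) = M^k(U_{k+1}(W))` with `U_{k+1}(W)` «in the axial gauge»): if in addition
`M^k(sel W)` and `M^k(sel (W^v))` are in the block axial gauge of a contour system `cd` of `T^{(k)}`, then `M^k(sel (W^v)) = (M^k(sel W))^{v∘blockOf}` EXACTLY
(§1: the lift of `M^k(sel W)` is axial, the two are fine-related, the fine element is `1`). [cite: Balaban1987RG1, (2.3) p.265; Balaban1985Variational, (181) p.307] -/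
theorem iter_sel_gaugeAct_of_axial (hk : k + 1 ≤ P.m + P.K)
    (hreg : ∀ (u : GaugeTransf P 0 G) (U : GaugeField P 0 G), U ∈ reg → gaugeAct u U ∈ reg) (cd : ContourData P k G)
    (hW : IsBackground av reg (k + 1) W (sel W)) (hvW : IsBackground av reg (k + 1) (gaugeAct v W) (sel (gaugeAct v W)))
    (huniq : ∀ U₀ U₀' : GaugeField P 0 G, IsBackground av reg (k + 1) (gaugeAct v W) U₀ → IsBackground av reg (k + 1) (gaugeAct v W) U₀' →
      OrbitRel (k + 1) U₀ U₀')
    (hax : AxialGauge cd (Averaging.iter av k (sel W))) (haxv : AxialGauge cd (Averaging.iter av k (sel (gaugeAct v W)))) :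
    Averaging.iter av k (sel (gaugeAct v W)) = gaugeAct (liftTransf v) (Averaging.iter av k (sel W)) := by
  obtain ⟨w, hw, h⟩ := iter_sel_gaugeAct_of_uniqueOrbit hk hreg hW hvW huniq
  rw [h] at haxv ⊢
  exact gaugeAct_eq_self_of_fine_of_axialGauge cd (axialGauge_gaugeAct_liftTransf hk cd v hax) hw haxv

/-- **THE NORMAL-FORM CONTRACT** (no axiality asked of `sel`): for ANY block-axial normal form `ax` of `T^{(k)}` (fine-related + axial, `exists_axialNormalForm`),
`ax (M^k(sel (W^v))) = (ax (M^k(sel W)))^{v∘blockOf}` from uniqueness of the minimal orbit over `W^v` alone — the re-gauged critical configuration IS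
block-lift covariant. [cite: Balaban1987RG1, (2.3) p.265; Balaban1985Variational, (181) p.307; Balaban1985RegularSpaces, (1.15) p.78] -/
theorem ax_iter_sel_gaugeAct (hk : k + 1 ≤ P.m + P.K)
    (hreg : ∀ (u : GaugeTransf P 0 G) (U : GaugeField P 0 G), U ∈ reg → gaugeAct u U ∈ reg) (cd : ContourData P k G)
    {ax : GaugeField P k G → GaugeField P k G}
    (hax₁ : ∀ V, ∃ u : GaugeTransf P k G, (∀ y : Site P (k + 1), u (emb y) = 1) ∧ ax V = gaugeAct u V) (hax₂ : ∀ V, AxialGauge cd (ax V))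
    (hW : IsBackground av reg (k + 1) W (sel W)) (hvW : IsBackground av reg (k + 1) (gaugeAct v W) (sel (gaugeAct v W)))
    (huniq : ∀ U₀ U₀' : GaugeField P 0 G, IsBackground av reg (k + 1) (gaugeAct v W) U₀ → IsBackground av reg (k + 1) (gaugeAct v W) U₀' →
      OrbitRel (k + 1) U₀ U₀') :
    ax (Averaging.iter av k (sel (gaugeAct v W))) = gaugeAct (liftTransf v) (ax (Averaging.iter av k (sel W))) := by
  obtain ⟨w, hw, h⟩ := iter_sel_gaugeAct_of_uniqueOrbit hk hreg hW hvW huniq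
  set V₀ := Averaging.iter av k (sel W) with hV₀
  obtain ⟨u₀, hu₀, e₀⟩ := hax₁ V₀
  obtain ⟨u₁, hu₁, e₁⟩ := hax₁ (Averaging.iter av k (sel (gaugeAct v W)))
  -- the two sides are fine-related: `ax V₁ = t · (lift v · ax V₀)` with `t = u₁ · w · (v∘B) · u₀⁻¹ · (v∘B)⁻¹`
  have key : ax (Averaging.iter av k (sel (gaugeAct v W))) =
      gaugeAct (fun x => u₁ x * w x * liftTransf v x * (u₀ x)⁻¹ * (liftTransf v x)⁻¹) (gaugeAct (liftTransf v) (ax V₀)) := by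
    rw [e₁, h, e₀]
    funext b
    simp only [GaugeField.gaugeAct, mul_inv_rev, inv_inv]
    group
  have ht : ∀ y : Site P (k + 1), (fun x => u₁ x * w x * liftTransf v x * (u₀ x)⁻¹ * (liftTransf v x)⁻¹) (emb y) = 1 := by
    intro y
    show u₁ (emb y) * w (emb y) * liftTransf v (emb y) * (u₀ (emb y))⁻¹ * (liftTransf v (emb y))⁻¹ = 1
    rw [hu₁ y, hw y, hu₀ y, liftTransf_emb hk v y, inv_one, one_mul, one_mul, mul_one, mul_inv_cancel]
  have haxR : AxialGauge cd (gaugeAct (liftTransf v) (ax V₀)) := axialGauge_gaugeAct_liftTransf hk cd v (hax₂ V₀)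
  have haxL : AxialGauge cd (gaugeAct (fun x => u₁ x * w x * liftTransf v x * (u₀ x)⁻¹ * (liftTransf v x)⁻¹) (gaugeAct (liftTransf v) (ax V₀))) := by
    rw [← key]
    exact hax₂ _
  rw [key]
  exact gaugeAct_eq_self_of_fine_of_axialGauge cd haxR ht haxL

/-- **LEVEL-0 TWIN — [B11] (181) ITSELF FOR A RE-GAUGED SELECTION**: for any normal form `nf` of the residual group of level `k+1` on `T_η` (constant on residual
orbits, commuting with the block-constant lift `v∘B^{k+1}` — e.g. a complete axial gauge of the group (4)), `nf (sel (W^v)) = (nf (sel W))^{v∘B^{k+1}}` from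
uniqueness of the minimal orbit over `W^v`. [cite: Balaban1985Variational, (181) p.307 and (4) p.278] -/
theorem nf_sel_gaugeAct (hk : k + 1 ≤ P.m + P.K)
    (hreg : ∀ (u : GaugeTransf P 0 G) (U : GaugeField P 0 G), U ∈ reg → gaugeAct u U ∈ reg) {nf : GaugeField P 0 G → GaugeField P 0 G}
    (hnf₁ : ∀ U U' : GaugeField P 0 G, OrbitRel (k + 1) U U' → nf U = nf U')
    (hnf₂ : ∀ U : GaugeField P 0 G, nf (gaugeAct (blockLift (k + 1) v) U) = gaugeAct (blockLift (k + 1) v) (nf U))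
    (hW : IsBackground av reg (k + 1) W (sel W)) (hvW : IsBackground av reg (k + 1) (gaugeAct v W) (sel (gaugeAct v W)))
    (huniq : ∀ U₀ U₀' : GaugeField P 0 G, IsBackground av reg (k + 1) (gaugeAct v W) U₀ → IsBackground av reg (k + 1) (gaugeAct v W) U₀' →
      OrbitRel (k + 1) U₀ U₀') :
    nf (sel (gaugeAct v W)) = gaugeAct (blockLift (k + 1) v) (nf (sel W)) := by
  rw [← hnf₁ _ _ (orbitRel_blockLift_of_uniqueOrbit hk hreg hW hvW huniq), hnf₂]

/-- … hence the critical configuration of the re-gauged selection is block-lift covariant: `M^k(nf (sel (W^v))) = (M^k(nf (sel W)))^{v∘blockOf}` (g0's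
`critCfgOfRecord_gaugeAct_of_Uk_blockLift` pattern). [cite: Balaban1987RG1, (2.3) p.265; Balaban1985Variational, (181) p.307] -/
theorem iter_nf_sel_gaugeAct (hk : k + 1 ≤ P.m + P.K)
    (hreg : ∀ (u : GaugeTransf P 0 G) (U : GaugeField P 0 G), U ∈ reg → gaugeAct u U ∈ reg) {nf : GaugeField P 0 G → GaugeField P 0 G}
    (hnf₁ : ∀ U U' : GaugeField P 0 G, OrbitRel (k + 1) U U' → nf U = nf U')
    (hnf₂ : ∀ U : GaugeField P 0 G, nf (gaugeAct (blockLift (k + 1) v) U) = gaugeAct (blockLift (k + 1) v) (nf U))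
    (hW : IsBackground av reg (k + 1) W (sel W)) (hvW : IsBackground av reg (k + 1) (gaugeAct v W) (sel (gaugeAct v W)))
    (huniq : ∀ U₀ U₀' : GaugeField P 0 G, IsBackground av reg (k + 1) (gaugeAct v W) U₀ → IsBackground av reg (k + 1) (gaugeAct v W) U₀' →
      OrbitRel (k + 1) U₀ U₀') :
    Averaging.iter av k (nf (sel (gaugeAct v W))) = gaugeAct (liftTransf v) (Averaging.iter av k (nf (sel W))) := by
  rw [nf_sel_gaugeAct hk hreg hnf₁ hnf₂ hW hvW huniq, iter_gaugeAct av (blockLift (k + 1) v) _ k (Nat.le_of_succ_le hk),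
    toMS_blockLift_succ (Nat.le_of_succ_le hk) v]

/-- The re-gauged selection is still a selection of MINIMISERS: if `nf U` lies in the residual orbit of `U` (level `k+1`), the minimising property transfers
(dag-p07's `B12GaugeOrbits021.isBackground_iff_of_orbitRel`; [I] p. 256 «a set of minima»). [cite: Balaban1987RG1, (0.21) p.256] -/
theorem isBackground_nf_sel (hk : k + 1 ≤ P.m + P.K)
    (hreg : ∀ (u : GaugeTransf P 0 G) (U : GaugeField P 0 G), U ∈ reg → gaugeAct u U ∈ reg) {nf : GaugeField P 0 G → GaugeField P 0 G}
    (hnf₀ : ∀ U : GaugeField P 0 G, OrbitRel (k + 1) U (nf U)) (hW : IsBackground av reg (k + 1) W (sel W)) :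
    IsBackground av reg (k + 1) W (nf (sel W)) :=
  (B12GaugeOrbits021.isBackground_iff_of_orbitRel hk (fun u _ U hU => hreg u U hU) W (hnf₀ (sel W))).1 hW

/-- Any gauge transformation `u` of `T_η` maps residual orbits to residual orbits: `U' = U^w`, `w` residual of level `k` ⇒ `U'^{u} = (U^{u})^{u·w·u⁻¹}` with the
conjugate again residual (`u(y)·1·u(y)⁻¹ = 1` at the sites of `T^{(k)}`). [cite: Balaban1985Variational, (4) p.278 (bookkeeping)] -/
theorem orbitRel_gaugeAct (u : GaugeTransf P 0 G) {U U' : GaugeField P 0 G} (h : OrbitRel k U U') :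
    OrbitRel k (gaugeAct u U) (gaugeAct u U') := by
  obtain ⟨w, hw, rfl⟩ := h
  refine ⟨fun x => u x * w x * (u x)⁻¹, fun y => ?_, ?_⟩
  · show u (embIter k y) * w (embIter k y) * (u (embIter k y))⁻¹ = 1
    rw [hw y, mul_one, mul_inv_cancel]
  · funext b
    simp only [GaugeField.gaugeAct, mul_inv_rev, inv_inv]
    group

end Selection

/-! ## §3. The record (`SU(N)`, `avOfRecord`, `bgReg`, `Uk … (k+1) ν.εreg`): `hcov` from [B11] uniqueness + the axial convention; the junction re-keyed -/

variable {F : T4Continuum.T4Family} {N : ℕ} [NeZero N]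

/-- **THE UNIQUE-ORBIT SET OF THE (0.21) PROBLEM OF RECORD IS GAUGE INVARIANT** (companion of g0's `ukExists_gaugeAct_iff`): for `k ≤ m + K` and a gauge
transformation `v` of `T^{(k)}`, the minimal orbit over `W^v` is unique (under the residual group of level `k`) iff the one over `W` is — transport of both
minimisers by the block-constant lift `v∘B^k` (`(v∘B^k)↾T^{(k)} = v`) and conjugation of the residual element by its inverse (`orbitRel_gaugeAct`).
[cite: Balaban1985Variational, Thm 1 p.279 and (181) p.307; Balaban1987RG1, (1.1) p.260] -/
theorem uniqueUkOrbit_gaugeAct_iff {K k : ℕ} (hk : k ≤ (F.P K).m + (F.P K).K) (ε : ℝ) (v : GaugeTransf (F.P K) k (SU N))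
    (W : GaugeField (F.P K) k (SU N)) : UniqueUkOrbit F N K k ε (gaugeAct v W) ↔ UniqueUkOrbit F N K k ε W := by
  have key : ∀ (v : GaugeTransf (F.P K) k (SU N)) (W : GaugeField (F.P K) k (SU N)),
      UniqueUkOrbit F N K k ε (gaugeAct v W) → UniqueUkOrbit F N K k ε W := by
    intro v W h U₀ U₀' h₀ h₀'
    have t₀ := isBackground_gaugeAct_toMS (av := avOfRecord F N K) (reg := bgReg F N K k ε) hk (fun u U hU => gaugeAct_mem_bgReg u U hU) h₀
      (blockLift k v)
    have t₀' := isBackground_gaugeAct_toMS (av := avOfRecord F N K) (reg := bgReg F N K k ε) hk (fun u U hU => gaugeAct_mem_bgReg u U hU) h₀'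
      (blockLift k v)
    rw [toMS_blockLift_self hk] at t₀ t₀'
    have e := orbitRel_gaugeAct (invTransf (blockLift k v)) (h _ _ t₀ t₀')
    rwa [gaugeAct_inv_gaugeAct, gaugeAct_inv_gaugeAct] at e
  exact ⟨key v W, fun h => key (invTransf v) (gaugeAct v W) (by rwa [gaugeAct_inv_gaugeAct])⟩

/-- **(181) MODULO THE RESIDUAL GROUP FOR THE BARE CHOICE OF RECORD**: on the unique-orbit part of the solvable set, `U_{k+1}(W^v)` lies in the residual orbit of
`U_{k+1}(W)^{v∘B^{k+1}}` — hypothesis-free in the choice (`isBackground_Uk` on both sides, `ukExists_gaugeAct_iff`, `uniqueUkOrbit_gaugeAct_iff`).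
[cite: Balaban1985Variational, (181) p.307 and Thm 1 p.279; Balaban1987RG1, (0.21) p.256] -/
theorem Uk_gaugeAct_orbitRel_blockLift {K k : ℕ} (hk : k + 1 ≤ (F.P K).m + (F.P K).K) (ε : ℝ) (v : GaugeTransf (F.P K) (k + 1) (SU N))
    {W : GaugeField (F.P K) (k + 1) (SU N)} (hW : UkExists F N K (k + 1) ε W) (huW : UniqueUkOrbit F N K (k + 1) ε W) :
    OrbitRel (k + 1) (gaugeAct (blockLift (k + 1) v) (Uk F N K (k + 1) ε W)) (Uk F N K (k + 1) ε (gaugeAct v W)) :=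
  orbitRel_blockLift_of_uniqueOrbit (av := avOfRecord F N K) (reg := bgReg F N K (k + 1) ε) (sel := Uk F N K (k + 1) ε) hk
    (fun u U hU => gaugeAct_mem_bgReg u U hU) (isBackground_Uk hW) (isBackground_Uk ((ukExists_gaugeAct_iff hk ε v W).2 hW))
    ((uniqueUkOrbit_gaugeAct_iff hk ε v W).2 huW)

/-- ★ **`hcov` AT ONE COARSE FIELD FROM UNIQUENESS + AXIALITY**: if the level-`(k+1)` problem of record at `W` is solvable with a UNIQUE minimal orbit at the
cut-off's radius `ν.εreg` ([B11] Thm 1), and the record's critical configuration (2.3) is in the block axial gauge of a contour system `cd` of `T^{(k)}` at `W`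
and at `W^v` ([I] (2.3)'s convention), then `V^{(k)}(W^v) = (V^{(k)}(W))^{v∘blockOf}`. [cite: Balaban1987RG1, (2.3) p.265; Balaban1985Variational, Thm 1 p.279 and (181) p.307] -/
theorem critCfgOfRecord_gaugeAct_of_uniqueOrbit_of_axial {ν : Stage7Numerics} {K k : ℕ} (hk : k + 1 ≤ (F.P K).m + (F.P K).K)
    (cd : ContourData (F.P K) k (SU N)) (v : GaugeTransf (F.P K) (k + 1) (SU N)) {W : GaugeField (F.P K) (k + 1) (SU N)}
    (hW : UkExists F N K (k + 1) ν.εreg W) (huW : UniqueUkOrbit F N K (k + 1) ν.εreg W)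
    (hax : AxialGauge cd (critCfgOfRecord F N ν K k W)) (haxv : AxialGauge cd (critCfgOfRecord F N ν K k (gaugeAct v W))) :
    critCfgOfRecord F N ν K k (gaugeAct v W) = gaugeAct (liftTransf v) (critCfgOfRecord F N ν K k W) :=
  iter_sel_gaugeAct_of_axial (av := avOfRecord F N K) (reg := bgReg F N K (k + 1) ν.εreg) (sel := Uk F N K (k + 1) ν.εreg) hk
    (fun u U hU => gaugeAct_mem_bgReg u U hU) cd (isBackground_Uk hW) (isBackground_Uk ((ukExists_gaugeAct_iff hk ν.εreg v W).2 hW))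
    ((uniqueUkOrbit_gaugeAct_iff hk ν.εreg v W).2 huW) hax haxv

/-- ★ **THE (181)ˢᵒˡ BINDER `hcov j` OF THE JUNCTION, DERIVED**: its body, VERBATIM, from [B11] Thm 1's uniqueness clause at radius `ν.εreg` on the solvable set
and the axiality of the record's (2.3) there (both DISPLAYED; the second is print's convention, satisfiable by the one-token re-point §2 prices).
[cite: Balaban1987RG1, (2.3) p.265; Balaban1985Variational, Thm 1 p.279 and (181) p.307] -/
theorem critCfgOfRecord_covariantOn_of_uniqueOrbit_of_axialOn {ν : Stage7Numerics} {K k : ℕ} (hk : k + 1 ≤ (F.P K).m + (F.P K).K)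
    (cd : ContourData (F.P K) k (SU N))
    (huniq : ∀ W : GaugeField (F.P K) (k + 1) (SU N), UkExists F N K (k + 1) ν.εreg W → UniqueUkOrbit F N K (k + 1) ν.εreg W)
    (hax : ∀ W : GaugeField (F.P K) (k + 1) (SU N), UkExists F N K (k + 1) ν.εreg W → AxialGauge cd (critCfgOfRecord F N ν K k W)) :
    ∀ (v : GaugeTransf (F.P K) (k + 1) (SU N)) (W : GaugeField (F.P K) (k + 1) (SU N)), UkExists F N K (k + 1) ν.εreg W →
      critCfgOfRecord F N ν K k (gaugeAct v W) = gaugeAct (liftTransf v) (critCfgOfRecord F N ν K k W) :=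
  fun v W hW => critCfgOfRecord_gaugeAct_of_uniqueOrbit_of_axial hk cd v hW (huniq W hW) (hax W hW)
    (hax _ ((ukExists_gaugeAct_iff hk ν.εreg v W).2 hW))

/-- **`χ^{(2.9)}_j` IS LIFT-INVARIANT ON `Ū⁻¹(S)` FROM UNIQUENESS + AXIALITY ON `S`** (`θ₀ : Stage13Params`, `j < K`, `S` gauge-stable inside the level-`(j+1)`
solvable set at radius `θ₀.ν.εreg`): g0's FILE 1 `chiFix29OfRecord_gaugeAct_liftTransf_of_critCfg` at the covariance `critCfgOfRecord_gaugeAct_of_uniqueOrbit_of_axial`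
(the cut-off is coupling-blind, `rfl`).  The localised (M1) of FILE 4 §2 with `hcov` DERIVED. [cite: Balaban1987RG1, (2.9) p.266 and (2.3) p.265; Balaban1985Variational, Thm 1 p.279] -/
theorem chiβ_liftInvariantOn_of_uniqueOrbit_of_axialOn (θ₀ : Stage13Params F N) (K : ℕ) (g : ℕ → ℝ) {j : ℕ} (hj : j < K)
    (cd : ContourData (F.P K) j (SU N)) {S : Set (GaugeField (F.P K) (j + 1) (SU N))}
    (hSst : ∀ (v : GaugeTransf (F.P K) (j + 1) (SU N)) (W : GaugeField (F.P K) (j + 1) (SU N)), W ∈ S → gaugeAct v W ∈ S)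
    (hSsol : ∀ W ∈ S, UkExists F N K (j + 1) θ₀.ν.εreg W) (huniq : ∀ W ∈ S, UniqueUkOrbit F N K (j + 1) θ₀.ν.εreg W)
    (hax : ∀ W ∈ S, AxialGauge cd (critCfgOfRecord F N θ₀.ν K j W)) :
    ∀ (v : GaugeTransf (F.P K) (j + 1) (SU N)) (U : GaugeField (F.P K) j (SU N)), (avOfRecord F N K j).avg U ∈ S →
      chiβOfRecord₁₃ F N θ₀ K g j (gaugeAct (liftTransf v) U) = chiβOfRecord₁₃ F N θ₀ K g j U :=
  fun v U hU => chiFix29OfRecord_gaugeAct_liftTransf_of_critCfg θ₀.ε₂₉ (succ_le_range_of_lt hj) v U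
    (critCfgOfRecord_gaugeAct_of_uniqueOrbit_of_axial (succ_le_range_of_lt hj) cd v (hSsol _ hU) (huniq _ hU) (hax _ hU) (hax _ (hSst v _ hU)))

/-- **THE NORMAL-FORM CONTRACT AT THE RECORD** (the drop-in's theorem): for ANY block-axial normal form `ax` of `T^{(k)}`, the RE-GAUGED critical configuration
`W ↦ ax (V^{(k)}(W))` is block-lift covariant on the unique-orbit part of the solvable set — from [B11] uniqueness ALONE, nothing asked of the bare choice `Uk`.
[cite: Balaban1987RG1, (2.3) p.265; Balaban1985Variational, (181) p.307; Balaban1985RegularSpaces, (1.15) p.78] -/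
theorem ax_critCfgOfRecord_gaugeAct {ν : Stage7Numerics} {K k : ℕ} (hk : k + 1 ≤ (F.P K).m + (F.P K).K) (cd : ContourData (F.P K) k (SU N))
    {ax : GaugeField (F.P K) k (SU N) → GaugeField (F.P K) k (SU N)}
    (hax₁ : ∀ V, ∃ u : GaugeTransf (F.P K) k (SU N), (∀ y : Site (F.P K) (k + 1), u (emb y) = 1) ∧ ax V = gaugeAct u V)
    (hax₂ : ∀ V, AxialGauge cd (ax V)) (v : GaugeTransf (F.P K) (k + 1) (SU N)) {W : GaugeField (F.P K) (k + 1) (SU N)}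
    (hW : UkExists F N K (k + 1) ν.εreg W) (huW : UniqueUkOrbit F N K (k + 1) ν.εreg W) :
    ax (critCfgOfRecord F N ν K k (gaugeAct v W)) = gaugeAct (liftTransf v) (ax (critCfgOfRecord F N ν K k W)) :=
  ax_iter_sel_gaugeAct (av := avOfRecord F N K) (reg := bgReg F N K (k + 1) ν.εreg) (sel := Uk F N K (k + 1) ν.εreg) hk
    (fun u U hU => gaugeAct_mem_bgReg u U hU) cd hax₁ hax₂ (isBackground_Uk hW) (isBackground_Uk ((ukExists_gaugeAct_iff hk ν.εreg v W).2 hW))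
    ((uniqueUkOrbit_gaugeAct_iff hk ν.εreg v W).2 huW)

/-- The re-gauged critical configuration stays in the fibre over `W`: `M(ax (V^{(k)}(W))) = W` on the solvable set (K0e's `avg_critCfgOfRecord` + §1).
[cite: Balaban1987RG1, (2.3)–(2.4) pp.265–266] -/
theorem avg_ax_critCfgOfRecord {ν : Stage7Numerics} {K k : ℕ} (hk : k + 1 ≤ (F.P K).m + (F.P K).K)
    {ax : GaugeField (F.P K) k (SU N) → GaugeField (F.P K) k (SU N)}
    (hax₁ : ∀ V, ∃ u : GaugeTransf (F.P K) k (SU N), (∀ y : Site (F.P K) (k + 1), u (emb y) = 1) ∧ ax V = gaugeAct u V)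
    {W : GaugeField (F.P K) (k + 1) (SU N)} (hW : UkExists F N K (k + 1) ν.εreg W) :
    (avOfRecord F N K k).avg (ax (critCfgOfRecord F N ν K k W)) = W := by
  rw [avg_ax_eq hk (avOfRecord F N K k) hax₁, avg_critCfgOfRecord hW]

/-- ★★ **THE THEOREM-3 MEMBER OF N09 AT `(w, P)`, STAGE-13 v1.7 CONSTRUCTION, (181)ˢᵒˡ REPLACED BY [B11] UNIQUENESS + THE AXIAL CONVENTION ON THE BOOKKEEPING
SETS**: g0's FILE 4 `thm3Member_stage13SepCoPH_of_stepsOnLoc` with its first binder `hcov` (on the whole solvable set) REPLACED by — `huniqD`: the minimal orbit of the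
level-`(j+1)` problem at radius `θ.ν.εreg` is unique at every `W ∈ D (j+1)` ([B11] Thm 1); `haxD`: the record's critical configuration (2.3) is in the block axial gauge of
a contour family `cd j` at every `W ∈ D (j+1)` ([I] (2.3)).  Every other binder — `D (j+1)` inside the solvable set, open, measurable, gauge-stable, the localised support
clause, (I19), `hreg`, [B11] ×3 at radius `θ.εbg` on `domAltOfRecord θ.ν`, the nesting — VERBATIM.  Proof: FILE 3 `thm3Member_of_indATPlug_of_stepsOnLoc` fed exactly as
in FILE 4, the χ-input by `chiβ_liftInvariantOn_of_uniqueOrbit_of_axialOn` on `S := D (j+1)`.  CONDITIONAL on every displayed hypothesis; nothing of Bałaban asserted;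
N09 NOT discharged. [cite: Balaban1987RG1, Thm 3 p.264, (1.1)–(1.3) p.260, (2.1)–(2.3) p.265, (2.9)–(2.10) pp.266–267; Balaban1985Variational, Thm 1 (8)–(10) p.279 and (181) p.307] -/
theorem thm3Member_stage13SepCoPH_of_stepsOnLoc_of_axialOn (θ : Stage13HParams F N) (h : θ.Provisos₁₃SepCoPH F N) {w : WorldP}
    (hC : w.C = (datumOfRecord₁₃SepCoPH F N θ h).C) (P : B12.RunParams) (D : (j : ℕ) → Set (GaugeField (F.P P.K) j (SU N)))
    (cd : (j : ℕ) → ContourData (F.P P.K) j (SU N))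
    (huniqD : ∀ j < P.K, ∀ W ∈ D (j + 1), UniqueUkOrbit F N P.K (j + 1) θ.toStage13Params.ν.εreg W)
    (haxD : ∀ j < P.K, ∀ W ∈ D (j + 1), AxialGauge (cd j) (critCfgOfRecord F N θ.toStage13Params.ν P.K j W))
    (hDsol : ∀ j < P.K, ∀ W ∈ D (j + 1), UkExists F N P.K (j + 1) θ.toStage13Params.ν.εreg W)
    (hDo : ∀ j < P.K, IsOpen (D (j + 1))) (hDm : ∀ j < P.K, MeasurableSet (D (j + 1)))
    (hDst : ∀ j < P.K, ∀ (v : GaugeTransf (F.P P.K) (j + 1) (SU N)) (V : GaugeField (F.P P.K) (j + 1) (SU N)), V ∈ D (j + 1) → gaugeAct v V ∈ D (j + 1))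
    (hχD : ∀ j < P.K, ∀ U : GaugeField (F.P P.K) j (SU N), (avOfRecord F N P.K j).avg U ∈ D (j + 1) → U ∉ D j →
      chiβOfRecord₁₃ F N θ.toStage13Params P.K (gOfRecord₁₃ F N θ.toStage13Params P) j U = 0)
    (hint : ∀ j < P.K, Integrable (betaInputOfRecord F N (TβOfRecord₁₃ F N) (chiβOfRecord₁₃ F N θ.toStage13Params) P.K (gOfRecord₁₃ F N θ.toStage13Params P) j)
      (fieldMeasure (F.P P.K) j (SU N)))
    (hreg : ∀ j < P.K, D (j + 1) ⊆ regSetOfRecord F N P.K j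
      (betaInputOfRecord F N (TβOfRecord₁₃ F N) (chiβOfRecord₁₃ F N θ.toStage13Params) P.K (gOfRecord₁₃ F N θ.toStage13Params P) j))
    (h11 : ∀ k, k ≤ P.K → ∀ V ∈ domAltOfRecord F N θ.ν P.K k, UkExists F N P.K k θ.εbg V ∧ UniqueUkOrbit F N P.K k θ.εbg V)
    (hres : ∀ k, k ≤ P.K → HRestrict F N θ.εbg P.K k (domAltOfRecord F N θ.ν P.K k))
    (huniq : ∀ k, k ≤ P.K → ∀ V ∈ domAltOfRecord F N θ.ν P.K k, ∀ j < k,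
      UniqueUkOrbit F N P.K (j + 1) θ.εbg (Averaging.iter (avOfRecord F N P.K) (j + 1) (Uk F N P.K k θ.εbg V)))
    (hnest : ∀ k, k ≤ P.K → ∀ V ∈ domAltOfRecord F N θ.ν P.K k, ∀ j < k, Averaging.iter (avOfRecord F N P.K) j (Uk F N P.K k θ.εbg V) ∈ D j) :
    (leavesP w P).smallCouplings → (leavesP w P).smallFieldInductive :=
  thm3Member_of_indATPlug_of_stepsOnLoc (TβOfRecord₁₃ F N) (chiβOfRecord₁₃ F N θ.toStage13Params) θ.εbg (betaOfRecord₁₃ F N θ.toStage13Params)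
    (fun k => domAltOfRecord F N θ.ν P.K k) D
    (by rw [hC]; exact flow_stage13SepCoPH F N θ h P) (fun k _ => by rw [hC]; exact indAss_stage13SepCoPH_iff F N θ h P k)
    (fun _ _ _ _ => rfl)
    (fun j hj => chiβ_liftInvariantOn_of_uniqueOrbit_of_axialOn θ.toStage13Params P.K (gOfRecord₁₃ F N θ.toStage13Params P) hj (cd j)
      (hDst j hj) (hDsol j hj) (huniqD j hj) (haxD j hj)) hχD
    (fun j hj => stepOnLoc_TβOfRecord₁₃ hj _ (hint j hj) (hDo j hj) (hDm j hj) (hDst j hj) (hreg j hj)) h11 hres huniq hnest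

end Summit.QuantumFields.YangMills.BalabanUVNodes.N09AxialCovariance181
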